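import Summits.HodgeConjecture.CorCM.IrreducibleOddWeightsIsotypicFrobeniusHomAdditivity
import HarnessLib

/-!
# Isotypic cells, Frobenius VIII: THE INTERTWINING NUMBER OF TWO TRANSITIVE SLOTS —
# `dim (ℚ^{Y₂})^{Stab(x₁)} = dim Hom_G(ℚ^{Y₁}, ℚ^{Y₂}) = Σ_c m_{1,c}·m_{2,c}·δ_c`, and `Σ_c m_c²·δ_c` Hecke dimensions

COR-CM (cell `pub-hodgecm2`, binder seat `b16` gen 77, count-neutral claim FROBENIUS RECIPROCITY IN THE REFERENCE
CURRENCY — MULTIPLICITIES FROM FIXED POINTS, file R8; theorems only, no definition, no named fact, no `sorry`).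
NEW as stated, hence under `Summits/`.  HONEST FRAMING: finite-dimensional linear algebra — Mackey's
intertwining-number formula for two permutation modules over `ℚ`: for transitive slots `Y₁ ∋ x₁` and `Y₂`
decomposed over the same pairwise non-embeddable references `A_c` (multiplicities `m_{1,c} = |J₁_c|`,
`m_{2,c} = |J₂_c|`, commutants `𝒟_c`, `δ_c = dim 𝒟_c·a₀_c = dim_ℚ End_G(A_c)`), the space of
`Stab(x₁)`-INVARIANT VECTORS of `ℚ^{Y₂}` (the functions on `Y₂` constant on the `Stab(x₁)`-orbits, one dimension
per orbit / per double coset `Stab(x₁)\G/Stab(x₂)`) has dimension **`Σ_c m_{1,c}·m_{2,c}·δ_c`**; for `Y₁ = Y₂`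
this is the dimension **`Σ_c m_c²·δ_c`** of the Hecke algebra `End_G(ℚ^{Y})`.  For number fields: the functions
on `Hom(K₂, ℂ)` invariant under `Aut(ℂ/x₁K₁)`.  Route: file R1 (`dim Hom_G(ℚ^{Y₁}, ℚ^{Y₂}) =
dim (ℚ^{Y₂})^{Stab(x₁)}`), file R7 (additivity over the summands `ι²_{c,j}(A_c)` of `ℚ^{Y₂}`, each Hom-space
`≅ Hom_G(ℚ^{Y₁}, A_c)`), file R2 (`dim Hom_G(ℚ^{Y₁}, A_c) = m_{1,c}·δ_c`).  Nothing about Hodge classes is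
asserted; `HC_CM` is neither used nor asserted.

* §1 **`finrank_fixed_eq_sum_card_mul_card_mul`** (M-series data for two slots over shared references):
  `dim F = Σ_c |J₁_c|·|J₂_c|·δ_c`, `F` the fixed subspace of `Stab(x₁)` in `ℚ^{Y₂}`; one slot
  **`finrank_fixed_eq_sum_card_sq_mul`**: `dim (ℚ^{Y})^{Stab(x₀)} = Σ_c |J_c|²·δ_c`.
* §2 NO INPUT BUT THE SLOTS: **`exists_isotypic_finrank_fixed_eq_sum`** — for finite `G`-sets `E_i` and the
  decomposition of gen 76 E3, `dim (ℚ^{E_{i₂}})^{Stab(x₁)} = Σ_c m_{i₁,c}·m_{i₂,c}·δ_c` for every transitive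
  `E_{i₁} ∋ x₁` and every `i₂`.
* §3 NUMBER FIELDS: **`exists_isotypic_finrank_fixed_eq_sum_numberField`** — the functions on `Hom(K_{i₂}, ℂ)`
  invariant under `Aut(ℂ/x₁K_{i₁})` span `Σ_c m_{i₁,c}·m_{i₂,c}·δ_c` dimensions.

## References

* [Serre1977] J.-P. Serre, *Linear Representations of Finite Groups*, GTM 42, §7.2 Thm. 13 and Ex. 7.2–7.3
  (intertwining numbers of induced representations, double cosets), §2.6.
* [LangeRodriguez2022] H. Lange, R. E. Rodríguez, *Decomposition of Jacobians by Prym Varieties*, LNM 2310 (2022),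
  §2.8 eq. (2.18) and Lemma 2.8.1.
* [CurtisReiner1962] C. W. Curtis, I. Reiner, *Representation Theory of Finite Groups and Associative Algebras*,
  §27 (27.3).
-/

set_option autoImplicit false

noncomputable section

open scoped BigOperators Classical

universe u uC uJ uJ' v v' vC w

namespace Summit.HodgeConjecture.CorCM.IrrOdd

variable {G : Type w} [Group G]

/-! ### §1 The intertwining number of two transitive slots over shared references -/

section TwoSlots

variable {Y₁ : Type v} [MulAction G Y₁] [Fintype Y₁] {Y₂ : Type v'} [MulAction G Y₂] [Fintype Y₂]
  {C : Type uC} [Fintype C] {Yc : C → Type vC} [∀ c, MulAction G (Yc c)] [∀ c, Fintype (Yc c)]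
  {Ar : ∀ c, Submodule ℚ (Yc c → ℚ)} {𝒟 : ∀ c, Submodule ℚ ((Yc c → ℚ) →ₗ[ℚ] (Yc c → ℚ))}
  {J₁ : C → Type uJ} [∀ c, Fintype (J₁ c)] {J₂ : C → Type uJ'} [∀ c, Fintype (J₂ c)]

/-- **THE INTERTWINING NUMBER: `dim (ℚ^{Y₂})^{Stab(x₁)} = Σ_c |J₁_c|·|J₂_c|·δ_c`.**  Two slots `Y₁ ∋ x₁`
(transitive) and `Y₂` decomposed over the same pairwise non-embeddable stable irreducible references `A_c`
(embeddings `ι¹_{c,j}`, `ι²_{c,j}` equivariant and injective on `A_c`, images independent and spanning the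
respective slot), commutants `𝒟_c`, non-zero `a₀_c ∈ A_c`; `F` the subspace of `ℚ^{Y₂}` fixed by `Stab(x₁)`.  Then
`dim F = dim Hom_G(ℚ^{Y₁}, ℚ^{Y₂}) = Σ_{(c,j) ∈ slot 2} dim Hom_G(ℚ^{Y₁}, ι²_{c,j}(A_c)) = Σ_c |J₂_c|·|J₁_c|·δ_c`
(files R1, R7, R2). [cite: Serre1977, §7.2 Thm. 13 and Ex. 7.2–7.3] [cite: LangeRodriguez2022, §2.8 Lemma 2.8.1] -/
theorem finrank_fixed_eq_sum_card_mul_card_mul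
    (h𝒟 : ∀ c (L : (Yc c → ℚ) →ₗ[ℚ] (Yc c → ℚ)), L ∈ 𝒟 c ↔ (∀ a ∈ Ar c, L a ∈ Ar c) ∧
      ∀ (k : G) (a : Yc c → ℚ), a ∈ Ar c → L (fun y => a (k • y)) = fun y => L a (k • y))
    (hRst : ∀ c (k : G) (a : Yc c → ℚ), a ∈ Ar c → (fun y => a (k • y)) ∈ Ar c)
    (hRirr : ∀ c (W : Submodule ℚ (Yc c → ℚ)), W ≤ Ar c → W ≠ ⊥ →
      (∀ (k : G) (f : Yc c → ℚ), f ∈ W → (fun y => f (k • y)) ∈ W) → W = Ar c)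
    (hsep : ∀ c c' (L : (Yc c → ℚ) →ₗ[ℚ] (Yc c' → ℚ)), c ≠ c' → Ar c ≠ ⊥ → (∀ a ∈ Ar c, L a ∈ Ar c') →
      (∀ a ∈ Ar c, L a = 0 → a = 0) →
      (∀ (k : G) (a : Yc c → ℚ), a ∈ Ar c → L (fun y => a (k • y)) = fun y => L a (k • y)) → False)
    (ι₁ : ∀ c, J₁ c → ((Yc c → ℚ) →ₗ[ℚ] (Y₁ → ℚ)))
    (hι₁eq : ∀ c (j : J₁ c) (k : G) (a : Yc c → ℚ), a ∈ Ar c →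
      ι₁ c j (fun y => a (k • y)) = fun y => ι₁ c j a (k • y))
    (hinj₁ : ∀ c (j : J₁ c) (a : Yc c → ℚ), a ∈ Ar c → ι₁ c j a = 0 → a = 0)
    (hindep₁ : iSupIndep fun q : (Σ c, J₁ c) => (Ar q.1).map (ι₁ q.1 q.2))
    (htop₁ : (⨆ c, ⨆ j, (Ar c).map (ι₁ c j)) = ⊤)
    (ι₂ : ∀ c, J₂ c → ((Yc c → ℚ) →ₗ[ℚ] (Y₂ → ℚ)))
    (hι₂eq : ∀ c (j : J₂ c) (k : G) (a : Yc c → ℚ), a ∈ Ar c →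
      ι₂ c j (fun y => a (k • y)) = fun y => ι₂ c j a (k • y))
    (hinj₂ : ∀ c (j : J₂ c) (a : Yc c → ℚ), a ∈ Ar c → ι₂ c j a = 0 → a = 0)
    (hindep₂ : iSupIndep fun q : (Σ c, J₂ c) => (Ar q.1).map (ι₂ q.1 q.2))
    (htop₂ : (⨆ c, ⨆ j, (Ar c).map (ι₂ c j)) = ⊤)
    {a₀ : ∀ c, Yc c → ℚ} (ha₀ : ∀ c, a₀ c ∈ Ar c) (h0 : ∀ c, a₀ c ≠ 0)
    {x₁ : Y₁} (htr₁ : ∀ x : Y₁, ∃ g : G, g • x₁ = x) {F : Submodule ℚ (Y₂ → ℚ)}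
    (hF : ∀ f : Y₂ → ℚ, f ∈ F ↔ ∀ k : G, k • x₁ = x₁ → (fun y => f (k • y)) = f) :
    Module.finrank ℚ F = ∑ c, Fintype.card (J₁ c) * Fintype.card (J₂ c) *
      Module.finrank ℚ ↥((𝒟 c).map (LinearMap.applyₗ (a₀ c))) := by
  -- the Hom-space into all of `ℚ^{Y₂}` has the dimension of the invariants (R1)
  obtain ⟨𝓗t, h𝓗t⟩ := exists_homSpace (G := G) (Y₀ := Y₁) (⊤ : Submodule ℚ (Y₂ → ℚ))
  have htdim : Module.finrank ℚ 𝓗t = Module.finrank ℚ F := by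
    rw [finrank_homSpace_eq h𝓗t hF (fun k a _ => Submodule.mem_top) htr₁, top_inf_eq]
  -- the Hom-spaces into the summands `ι²_{c,j}(A_c)` and into the references `A_c`
  have hs := fun q : (Σ c, J₂ c) => exists_homSpace (G := G) (Y₀ := Y₁) ((Ar q.1).map (ι₂ q.1 q.2))
  choose 𝓗s h𝓗s using hs
  have hA := fun c : C => exists_homSpace (G := G) (Y₀ := Y₁) (Ar c)
  choose 𝓗A h𝓗A using hA
  have hNst : ∀ (q : Σ c, J₂ c) (k : G) (v : Y₂ → ℚ), v ∈ (Ar q.1).map (ι₂ q.1 q.2) →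
      (fun y => v (k • y)) ∈ (Ar q.1).map (ι₂ q.1 q.2) := by
    rintro q k _ ⟨a, ha, rfl⟩
    exact ⟨fun y => a (k • y), hRst q.1 k a ha, hι₂eq q.1 q.2 k a ha⟩
  have htop₂' : (⨆ q : (Σ c, J₂ c), (Ar q.1).map (ι₂ q.1 q.2)) = ⊤ := by
    rw [iSup_sigma]
    exact htop₂
  have hsum := finrank_homSpace_top_eq_sum h𝓗t h𝓗s hNst hindep₂ htop₂'
  have hq : ∀ (c : C) (j : J₂ c), Module.finrank ℚ (𝓗s ⟨c, j⟩) =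
      Fintype.card (J₁ c) * Module.finrank ℚ ↥((𝒟 c).map (LinearMap.applyₗ (a₀ c))) := fun c j => by
    rw [finrank_homSpace_map_eq (h𝓗A c) (ι₂ c j) (h𝓗s ⟨c, j⟩) (hRst c) (hinj₂ c j) (hι₂eq c j)]
    exact finrank_homSpace_eq_card_mul (h𝓗A c) (h𝒟 c) hRst hRirr hsep ι₁ hι₁eq (hinj₁ c) hindep₁ htop₁
      (ha₀ c) (h0 c)
  rw [← htdim, hsum, Fintype.sum_sigma]
  refine Finset.sum_congr rfl fun c _ => ?_
  rw [Finset.sum_congr rfl fun j _ => hq c j, Finset.sum_const, Finset.card_univ, smul_eq_mul]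
  ring

variable {JJ : C → Type uJ} [∀ c, Fintype (JJ c)]

/-- **THE HECKE DIMENSION OF ONE TRANSITIVE SLOT: `dim (ℚ^{Y})^{Stab(x₀)} = Σ_c |J_c|²·δ_c`** (`= dim End_G(ℚ^Y)`,
one dimension per `Stab(x₀)`-orbit on `Y`). [cite: Serre1977, §7.2 Thm. 13 and Ex. 7.2–7.3]
[cite: LangeRodriguez2022, §2.8 Lemma 2.8.1] -/
theorem finrank_fixed_eq_sum_card_sq_mul
    (h𝒟 : ∀ c (L : (Yc c → ℚ) →ₗ[ℚ] (Yc c → ℚ)), L ∈ 𝒟 c ↔ (∀ a ∈ Ar c, L a ∈ Ar c) ∧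
      ∀ (k : G) (a : Yc c → ℚ), a ∈ Ar c → L (fun y => a (k • y)) = fun y => L a (k • y))
    (hRst : ∀ c (k : G) (a : Yc c → ℚ), a ∈ Ar c → (fun y => a (k • y)) ∈ Ar c)
    (hRirr : ∀ c (W : Submodule ℚ (Yc c → ℚ)), W ≤ Ar c → W ≠ ⊥ →
      (∀ (k : G) (f : Yc c → ℚ), f ∈ W → (fun y => f (k • y)) ∈ W) → W = Ar c)
    (hsep : ∀ c c' (L : (Yc c → ℚ) →ₗ[ℚ] (Yc c' → ℚ)), c ≠ c' → Ar c ≠ ⊥ → (∀ a ∈ Ar c, L a ∈ Ar c') →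
      (∀ a ∈ Ar c, L a = 0 → a = 0) →
      (∀ (k : G) (a : Yc c → ℚ), a ∈ Ar c → L (fun y => a (k • y)) = fun y => L a (k • y)) → False)
    (ι : ∀ c, JJ c → ((Yc c → ℚ) →ₗ[ℚ] (Y₁ → ℚ)))
    (hιeq : ∀ c (j : JJ c) (k : G) (a : Yc c → ℚ), a ∈ Ar c →
      ι c j (fun y => a (k • y)) = fun y => ι c j a (k • y))
    (hinj : ∀ c (j : JJ c) (a : Yc c → ℚ), a ∈ Ar c → ι c j a = 0 → a = 0)
    (hindep : iSupIndep fun q : (Σ c, JJ c) => (Ar q.1).map (ι q.1 q.2))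
    (htop : (⨆ c, ⨆ j, (Ar c).map (ι c j)) = ⊤)
    {a₀ : ∀ c, Yc c → ℚ} (ha₀ : ∀ c, a₀ c ∈ Ar c) (h0 : ∀ c, a₀ c ≠ 0)
    {x₀ : Y₁} (htr : ∀ x : Y₁, ∃ g : G, g • x₀ = x) {F : Submodule ℚ (Y₁ → ℚ)}
    (hF : ∀ f : Y₁ → ℚ, f ∈ F ↔ ∀ k : G, k • x₀ = x₀ → (fun y => f (k • y)) = f) :
    Module.finrank ℚ F = ∑ c, Fintype.card (JJ c) ^ 2 * Module.finrank ℚ ↥((𝒟 c).map (LinearMap.applyₗ (a₀ c))) := by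
  rw [finrank_fixed_eq_sum_card_mul_card_mul h𝒟 hRst hRirr hsep ι hιeq hinj hindep htop ι hιeq hinj hindep htop ha₀
    h0 htr hF]
  exact Finset.sum_congr rfl fun c _ => by rw [sq]

end TwoSlots

/-! ### §2 With no input but the slots -/

section NoInput

variable {I : Type u} {E : I → Type v} [∀ i, MulAction G (E i)] [∀ i, Fintype (E i)] [Fintype I]

/-- **THE INTERTWINING NUMBERS OF A FAMILY OF SLOTS, NO INPUT BUT THE SLOTS.**  For finite `G`-sets `E_i` there is
an isotypic decomposition `ℚ^{E_i} ≅ ⊕_c A_c^{m_{i,c}}` (gen 76 E3, with commutants `𝒟_c` and non-zero `a₀_c`,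
`δ_c = dim 𝒟_c·a₀_c`) such that for every slot `E_{i₁}` TRANSITIVE from `x₁`, every slot `E_{i₂}` and the
subspace `F ≤ ℚ^{E_{i₂}}` of `Stab(x₁)`-invariant vectors: **`dim F = Σ_c m_{i₁,c}·m_{i₂,c}·δ_c`**.
[cite: Serre1977, §7.2 Thm. 13 and Ex. 7.2–7.3] [cite: LangeRodriguez2022, §2.8 Lemma 2.8.1] -/
theorem exists_isotypic_finrank_fixed_eq_sum :
    ∃ (n : ℕ) (Ar : Fin n → Submodule ℚ ((Σ i, E i) → ℚ))
      (𝒟 : Fin n → Submodule ℚ (((Σ i, E i) → ℚ) →ₗ[ℚ] ((Σ i, E i) → ℚ))) (m : I → Fin n → ℕ)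
      (ι : ∀ (i : I) (c : Fin n), Fin (m i c) → (((Σ i, E i) → ℚ) →ₗ[ℚ] (E i → ℚ)))
      (a₀ : Fin n → ((Σ i, E i) → ℚ)),
      (∀ (c : Fin n) (L : ((Σ i, E i) → ℚ) →ₗ[ℚ] ((Σ i, E i) → ℚ)), L ∈ 𝒟 c ↔ (∀ a ∈ Ar c, L a ∈ Ar c) ∧
        ∀ (k : G) (a : (Σ i, E i) → ℚ), a ∈ Ar c → L (fun x => a (k • x)) = fun x => L a (k • x)) ∧
      (∀ (c : Fin n) (k : G) (a : (Σ i, E i) → ℚ), a ∈ Ar c → (fun x => a (k • x)) ∈ Ar c) ∧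
      (∀ (c : Fin n) (W : Submodule ℚ ((Σ i, E i) → ℚ)), W ≤ Ar c → W ≠ ⊥ →
        (∀ (k : G) (f : (Σ i, E i) → ℚ), f ∈ W → (fun x => f (k • x)) ∈ W) → W = Ar c) ∧
      (∀ c : Fin n, Ar c ≠ ⊥) ∧
      (∀ (c c' : Fin n) (L : ((Σ i, E i) → ℚ) →ₗ[ℚ] ((Σ i, E i) → ℚ)), c ≠ c' → Ar c ≠ ⊥ →
        (∀ a ∈ Ar c, L a ∈ Ar c') → (∀ a ∈ Ar c, L a = 0 → a = 0) →
        (∀ (k : G) (a : (Σ i, E i) → ℚ), a ∈ Ar c → L (fun x => a (k • x)) = fun x => L a (k • x)) →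
        False) ∧
      (∀ (i : I) (c : Fin n) (j : Fin (m i c)) (k : G) (a : (Σ i, E i) → ℚ), a ∈ Ar c →
        ι i c j (fun x => a (k • x)) = fun s => ι i c j a (k • s)) ∧
      (∀ (i : I) (c : Fin n) (j : Fin (m i c)) (a : (Σ i, E i) → ℚ), a ∈ Ar c → ι i c j a = 0 → a = 0) ∧
      (∀ i : I, iSupIndep fun q : (Σ c : Fin n, Fin (m i c)) => (Ar q.1).map (ι i q.1 q.2)) ∧
      (∀ i : I, (⨆ c : Fin n, ⨆ j : Fin (m i c), (Ar c).map (ι i c j)) = ⊤) ∧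
      (∀ c, a₀ c ∈ Ar c) ∧ (∀ c, a₀ c ≠ 0) ∧
      ∀ (i₁ i₂ : I) (x₁ : E i₁), (∀ x : E i₁, ∃ g : G, g • x₁ = x) →
        ∀ F : Submodule ℚ (E i₂ → ℚ),
          (∀ f : E i₂ → ℚ, f ∈ F ↔ ∀ k : G, k • x₁ = x₁ → (fun y => f (k • y)) = f) →
          Module.finrank ℚ F =
            ∑ c, m i₁ c * m i₂ c * Module.finrank ℚ ↥((𝒟 c).map (LinearMap.applyₗ (a₀ c))) := by
  obtain ⟨n, Ar, m, ι, hRst, hRirr, hR0, hsep, hιeq, hind, hindep, htop, -⟩ :=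
    exists_isotypic_decomposition (G := G) (E := E)
  obtain ⟨𝒟, h𝒟⟩ := exists_commutants (G := G) Ar
  obtain ⟨a₀, ha₀, h0⟩ := exists_mem_ne_zero_of_forall_ne_bot hR0
  have hinj : ∀ (i : I) (c : Fin n) (j : Fin (m i c)) (a : (Σ i, E i) → ℚ), a ∈ Ar c → ι i c j a = 0 → a = 0 :=
    fun i c j a ha hz => injOn_of_jointly_independent (ι i c) (hind i c) j a ha hz
  refine ⟨n, Ar, 𝒟, m, ι, a₀, h𝒟, hRst, hRirr, hR0, hsep, hιeq, hinj, hindep, htop, ha₀, h0,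
    fun i₁ i₂ x₁ htr₁ F hF => ?_⟩
  have h1 := finrank_fixed_eq_sum_card_mul_card_mul (Yc := fun _ : Fin n => Σ i, E i)
    (J₁ := fun c => Fin (m i₁ c)) (J₂ := fun c => Fin (m i₂ c)) h𝒟 hRst hRirr hsep (ι i₁) (hιeq i₁) (hinj i₁)
    (hindep i₁) (htop i₁) (ι i₂) (hιeq i₂) (hinj i₂) (hindep i₂) (htop i₂) ha₀ h0 htr₁ hF
  simpa only [Fintype.card_fin] using h1

end NoInput

end Summit.HodgeConjecture.CorCM.IrrOdd

/-! ### §3 Number fields -/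

namespace Summit.HodgeConjecture.CorCM

open NumberField
open Literature.NumberTheory.ComplexMultiplication
open Literature.AlgebraicGeometry.Pohlmann1968

variable {I : Type} [Fintype I] {K : I → Type} [∀ i, Field (K i)] [∀ i, NumberField (K i)]

/-- **THE INTERTWINING NUMBERS OF THE PERMUTATION MODULES `ℚ^{Hom(K_i, ℂ)}`.**  For number fields `K_i` there is
an `Aut(ℂ)`-isotypic decomposition `ℚ^{Hom(K_i, ℂ)} ≅ ⊕_c A_c^{m_{i,c}}` over pairwise non-embeddable irreducibles
(commutants `𝒟_c`, non-zero `a₀_c`, `δ_c = dim 𝒟_c·a₀_c`) such that for all `i₁, i₂`, every base embedding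
`x₁ : K_{i₁} → ℂ` and the subspace `F ≤ ℚ^{Hom(K_{i₂}, ℂ)}` of functions invariant under `Aut(ℂ/x₁K_{i₁})`
(constant on its orbits in `Hom(K_{i₂}, ℂ)`): **`dim F = Σ_c m_{i₁,c}·m_{i₂,c}·δ_c`**; for `i₁ = i₂` this is
`Σ_c m_{i,c}²·δ_c`. [cite: Serre1977, §7.2 Thm. 13 and Ex. 7.2–7.3] [cite: LangeRodriguez2022, §2.8 Lemma 2.8.1] -/
theorem exists_isotypic_finrank_fixed_eq_sum_numberField :
    ∃ (n : ℕ) (Ar : Fin n → Submodule ℚ ((Σ i, (K i →+* ℂ)) → ℚ))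
      (𝒟 : Fin n → Submodule ℚ (((Σ i, (K i →+* ℂ)) → ℚ) →ₗ[ℚ] ((Σ i, (K i →+* ℂ)) → ℚ)))
      (m : I → Fin n → ℕ)
      (ι : ∀ (i : I) (c : Fin n), Fin (m i c) → (((Σ i, (K i →+* ℂ)) → ℚ) →ₗ[ℚ] ((K i →+* ℂ) → ℚ)))
      (a₀ : Fin n → ((Σ i, (K i →+* ℂ)) → ℚ)),
      (∀ (c : Fin n) (L : ((Σ i, (K i →+* ℂ)) → ℚ) →ₗ[ℚ] ((Σ i, (K i →+* ℂ)) → ℚ)), L ∈ 𝒟 c ↔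
        (∀ a ∈ Ar c, L a ∈ Ar c) ∧ ∀ (k : ℂ ≃+* ℂ) (a : (Σ i, (K i →+* ℂ)) → ℚ), a ∈ Ar c →
          L (fun x => a (k • x)) = fun x => L a (k • x)) ∧
      (∀ (c : Fin n) (k : ℂ ≃+* ℂ) (a : (Σ i, (K i →+* ℂ)) → ℚ), a ∈ Ar c → (fun x => a (k • x)) ∈ Ar c) ∧
      (∀ (c : Fin n) (W : Submodule ℚ ((Σ i, (K i →+* ℂ)) → ℚ)), W ≤ Ar c → W ≠ ⊥ →
        (∀ (k : ℂ ≃+* ℂ) (f : (Σ i, (K i →+* ℂ)) → ℚ), f ∈ W → (fun x => f (k • x)) ∈ W) → W = Ar c) ∧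
      (∀ c : Fin n, Ar c ≠ ⊥) ∧
      (∀ (c c' : Fin n) (L : ((Σ i, (K i →+* ℂ)) → ℚ) →ₗ[ℚ] ((Σ i, (K i →+* ℂ)) → ℚ)), c ≠ c' → Ar c ≠ ⊥ →
        (∀ a ∈ Ar c, L a ∈ Ar c') → (∀ a ∈ Ar c, L a = 0 → a = 0) →
        (∀ (k : ℂ ≃+* ℂ) (a : (Σ i, (K i →+* ℂ)) → ℚ), a ∈ Ar c →
          L (fun x => a (k • x)) = fun x => L a (k • x)) → False) ∧
      (∀ (i : I) (c : Fin n) (j : Fin (m i c)) (k : ℂ ≃+* ℂ) (a : (Σ i, (K i →+* ℂ)) → ℚ), a ∈ Ar c →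
        ι i c j (fun x => a (k • x)) = fun s => ι i c j a (k • s)) ∧
      (∀ (i : I) (c : Fin n) (j : Fin (m i c)) (a : (Σ i, (K i →+* ℂ)) → ℚ), a ∈ Ar c →
        ι i c j a = 0 → a = 0) ∧
      (∀ i : I, iSupIndep fun q : (Σ c : Fin n, Fin (m i c)) => (Ar q.1).map (ι i q.1 q.2)) ∧
      (∀ i : I, (⨆ c : Fin n, ⨆ j : Fin (m i c), (Ar c).map (ι i c j)) = ⊤) ∧
      (∀ c, a₀ c ∈ Ar c) ∧ (∀ c, a₀ c ≠ 0) ∧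
      ∀ (i₁ i₂ : I) (x₁ : K i₁ →+* ℂ) (F : Submodule ℚ ((K i₂ →+* ℂ) → ℚ)),
        (∀ f : (K i₂ →+* ℂ) → ℚ, f ∈ F ↔ ∀ k : ℂ ≃+* ℂ, k • x₁ = x₁ → (fun y => f (k • y)) = f) →
        Module.finrank ℚ F =
          ∑ c, m i₁ c * m i₂ c * Module.finrank ℚ ↥((𝒟 c).map (LinearMap.applyₗ (a₀ c))) := by
  obtain ⟨n, Ar, 𝒟, m, ι, a₀, h𝒟, hRst, hRirr, hR0, hsep, hιeq, hinj, hindep, htop, ha₀, h0, hint⟩ :=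
    IrrOdd.exists_isotypic_finrank_fixed_eq_sum (G := ℂ ≃+* ℂ) (E := fun i => K i →+* ℂ)
  exact ⟨n, Ar, 𝒟, m, ι, a₀, h𝒟, hRst, hRirr, hR0, hsep, hιeq, hinj, hindep, htop, ha₀, h0,
    fun i₁ i₂ x₁ F hF => hint i₁ i₂ x₁ (exists_smul_embedding_eq x₁) F hF⟩

end Summit.HodgeConjecture.CorCM

end
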